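import Literature.Algebra.Polynomial.CasasAlvero.Char29Digits
import Literature.Algebra.Polynomial.CasasAlvero.Degree5
import Literature.Algebra.Polynomial.CasasAlvero.DigitReduction
import HarnessLib

/-!
# Casas-Alvero degrees in characteristic 29: the complete classification

Over EVERY field `K` of characteristic `29`: `CA_d(K) ⟺ d = 0 ∨ d = a·29^k` with `1 ≤ a ≤ 5`.
Ingredients: the digit reduction `CA_d ⇒ d = a·p^k ∧ CA_a` (`DigitReduction.lean`, any field); the positive digits `1, 2, 3, 4`
([GrafVonBothmerEtAl2007, Props. 2, 6], degree `≤ 4`) and `5` (`Degree5.lean`: `29` is not one of the nine bad primes of degree 5,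
and `CA_{5·p^k}` descends from the algebraic closure); and a refutation of every digit `6 ≤ a ≤ 28`:
`6, 7` by the degree-6 / degree-7 bad-prime tables; `14, 28` by the binomial criterion (`binom(14,5) ≡ binom(28,2) ≡ 1 (mod 29)`);
and the nineteen digits `8, …, 13, 15, …, 27` by the `𝔽_29`-rational trinomials of `Char29Digits.lean`.
-/

noncomputable section

open Polynomial

namespace Literature.Algebra.Polynomial.CasasAlvero

variable (K : Type*) [Field K] [CharP K 29]

/-- `CA_{5·29^k}` over every field of characteristic `29`. [cite: CastryckLaterveerOunaies2012, Thm. 4]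
[cite: GrafVonBothmerEtAl2007, Prop. 6] -/
theorem holdsInDegree_five_mul_twentyNine_pow (k : ℕ) : HoldsInDegree K (5 * 29 ^ k) := by
  haveI : Fact (Nat.Prime 29) := ⟨by norm_num⟩
  exact holdsInDegree_five_mul_prime_pow_field K 29 (by norm_num) (by norm_num) (by norm_num) (by norm_num)
    (by norm_num) (by norm_num) (by norm_num) (by norm_num) (by norm_num) k

/-- every digit `6 ≤ a < 29` fails: `¬ CA_a` over every field of characteristic `29`. [folklore] -/
theorem not_holdsInDegree_digit_of_char_twentyNine {a : ℕ} (h6 : 6 ≤ a) (hap : a < 29) : ¬ HoldsInDegree K a := by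
  haveI : Fact (Nat.Prime 29) := ⟨by norm_num⟩
  interval_cases a
  · exact not_holdsInDegree_six_of_charP K 29 (by decide)
  · exact not_holdsInDegree_seven_of_le K 29 (by norm_num) (by norm_num)
  · exact not_holdsInDegree_eight_of_char_29 K
  · exact not_holdsInDegree_nine_of_char_29 K
  · exact not_holdsInDegree_ten_of_char_29 K
  · exact not_holdsInDegree_eleven_of_char_29 K
  · exact not_holdsInDegree_twelve_of_char_29 K
  · exact not_holdsInDegree_thirteen_of_char_29 K
  · exact not_holdsInDegree_of_choose_modEq_one K 29 (d := 14) (m := 5) (by norm_num) (by norm_num) (by decide)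
  · exact not_holdsInDegree_fifteen_of_char_29 K
  · exact not_holdsInDegree_sixteen_of_char_29 K
  · exact not_holdsInDegree_seventeen_of_char_29 K
  · exact not_holdsInDegree_eighteen_of_char_29 K
  · exact not_holdsInDegree_nineteen_of_char_29 K
  · exact not_holdsInDegree_twenty_of_char_29 K
  · exact not_holdsInDegree_twentyOne_of_char_29 K
  · exact not_holdsInDegree_twentyTwo_of_char_29 K
  · exact not_holdsInDegree_twentyThree_of_char_29 K
  · exact not_holdsInDegree_twentyFour_of_char_29 K
  · exact not_holdsInDegree_twentyFive_of_char_29 K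
  · exact not_holdsInDegree_twentySix_of_char_29 K
  · exact not_holdsInDegree_twentySeven_of_char_29 K
  · exact not_holdsInDegree_of_choose_modEq_one K 29 (d := 28) (m := 2) (by norm_num) (by norm_num) (by decide)

/-- **characteristic 29, complete**: over every field of characteristic `29`,
`CA_d ⟺ d = 0 ∨ d = a·29^k` with `1 ≤ a ≤ 5`. [cite: GrafVonBothmerEtAl2007, Props. 2, 6, 7]
[cite: CastryckLaterveerOunaies2012, Thm. 4] -/
theorem classification_char_twentyNine_complete (d : ℕ) :
    HoldsInDegree K d ↔ d = 0 ∨ ∃ k a : ℕ, 0 < a ∧ a ≤ 5 ∧ d = a * 29 ^ k := by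
  haveI : Fact (Nat.Prime 29) := ⟨by norm_num⟩
  constructor
  · intro h
    rcases Nat.eq_zero_or_pos d with rfl | hd
    · exact Or.inl rfl
    obtain ⟨k, a, ha0, hap, rfl, ha⟩ := digit_of_holdsInDegree K 29 hd.ne' h
    refine Or.inr ⟨k, a, ha0, ?_, rfl⟩
    by_contra h5
    exact not_holdsInDegree_digit_of_char_twentyNine K (by omega) hap ha
  · rintro (rfl | ⟨k, a, ha0, ha5, rfl⟩)
    · exact holdsInDegree_zero K
    · interval_cases a
      · simpa using holdsInDegree_prime_pow_field K 29 k
      · exact holdsInDegree_two_mul_prime_pow_field K 29 k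
      · exact holdsInDegree_three_mul_prime_pow_field K 29 (by norm_num) k
      · exact holdsInDegree_mul_prime_pow_field K 29
          (holdsInDegree_of_le_four_of_charP (AlgebraicClosure K) 29 (by norm_num) le_rfl) k
      · exact holdsInDegree_five_mul_twentyNine_pow K k

/-- the set of Casas-Alvero degrees `≤ 841` in characteristic `29`, explicitly. [folklore] -/
theorem holdsInDegree_iff_mem_of_le_char_twentyNine_sq {d : ℕ} (hd : d ≤ 841) :
    HoldsInDegree K d ↔ d ∈ ({0, 1, 2, 3, 4, 5, 29, 58, 87, 116, 145, 841} : Finset ℕ) := by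
  rw [classification_char_twentyNine_complete]
  constructor
  · rintro (rfl | ⟨k, a, ha0, ha5, rfl⟩)
    · decide
    · rcases k with _ | _ | _ | k
      · interval_cases a <;> decide
      · interval_cases a <;> decide
      · interval_cases a <;> simp_all
      · exfalso
        have : 29 ^ 3 ≤ a * 29 ^ (k + 1 + 1 + 1) :=
          le_trans (Nat.pow_le_pow_right (by norm_num) (by omega)) (Nat.le_mul_of_pos_left _ ha0)
        omega
  · intro h
    simp only [Finset.mem_insert, Finset.mem_singleton] at h
    rcases h with rfl | rfl | rfl | rfl | rfl | rfl | rfl | rfl | rfl | rfl | rfl | rfl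
    · exact Or.inl rfl
    · exact Or.inr ⟨0, 1, by norm_num, by norm_num, by norm_num⟩
    · exact Or.inr ⟨0, 2, by norm_num, by norm_num, by norm_num⟩
    · exact Or.inr ⟨0, 3, by norm_num, by norm_num, by norm_num⟩
    · exact Or.inr ⟨0, 4, by norm_num, by norm_num, by norm_num⟩
    · exact Or.inr ⟨0, 5, by norm_num, by norm_num, by norm_num⟩
    · exact Or.inr ⟨1, 1, by norm_num, by norm_num, by norm_num⟩
    · exact Or.inr ⟨1, 2, by norm_num, by norm_num, by norm_num⟩
    · exact Or.inr ⟨1, 3, by norm_num, by norm_num, by norm_num⟩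
    · exact Or.inr ⟨1, 4, by norm_num, by norm_num, by norm_num⟩
    · exact Or.inr ⟨1, 5, by norm_num, by norm_num, by norm_num⟩
    · exact Or.inr ⟨2, 1, by norm_num, by norm_num, by norm_num⟩

end Literature.Algebra.Polynomial.CasasAlvero
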